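import Summits.HodgeConjecture.HodgeConjecture.Theorems.Ring2WeilCoverageTypeNormSignPrincipal
import Summits.HodgeConjecture.HodgeConjecture.Theorems.Ring2WeilCoverageCyclotomicSignaturesG8A
import Summits.HodgeConjecture.HodgeConjecture.Theorems.Ring2WeilCoverageCyclotomicSignaturesLevel32
import Summits.HodgeConjecture.HodgeConjecture.Theorems.Ring2WeilCoverageCMTypeSetOddPositions
import HarnessLib

/-!
# Weil-type family coverage — THE NORM-SIGN LAW AT THE YES LEVELS 32, 40 (THEOREM L (ii) only): on every census row
# `(ℚ(ζ_M), K)` at these levels, EVERY principal type `(ϖ₀)` with `N_{ℚ(ζ_M)⁺/ℚ}(ϖ₀) > 0` is carried by every `K`-balanced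
# point `ℂ^Φ/Φ(ℤ[ζ_M])`

research route conditional on HC_CM; not a corollary; Q11.4-sentence-2 already refuted in dim ≥ 3.

Ring 2, WEIL-TYPE FAMILY-COVERAGE CENSUS (`HOME/WEIL-FAMILY-COVERAGE.md` `## b01`, blocks b01.36–b01.41; owner ring2-b01), part 56d
of the `Ring2WeilCoverage*` series: the level files of part 55/55b (`…TypeNormSign`, `…TypeNormSignPrincipal`) at the levels
`M ∈ {32, 40}` (`g = 8`, `h(ℚ(ζ_M)) = 1`), where all census rows are YES rows (an `ι`-compatible PRINCIPAL polarisation exists on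
every `K`-balanced `ℂ^Φ/Φ(ℤ[ζ_M])`, b01.36) and THEOREM L (ii) (`exists_units_sign_eq_M`: every even sign pattern is a unit
pattern) is a hypothesis-free tree theorem, but THEOREM L (i) (positivity of the norms of the units of `ℤ[ζ_M]⁺`) is not in
the tree.  Part 55b's one-hypothesis half `exists_type_span_of_even_iff` then gives the EXISTENCE direction of the norm-sign
law, for every real `ϖ₀ ∈ 𝓞 K⁺` at once: rows `(32, ℚ(i))`, `(32, ℚ(√−2))`, `(40, ℚ(i))`, `(40, ℚ(√−2))`, `(40, ℚ(√−5))`, `(40, ℚ(√−10))` — **`N_{K⁺/ℚ}(ϖ₀) > 0` ⇒ type `(ϖ₀)` occurs** (degree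
`N_{K⁺/ℚ}(ϖ₀)`), the principal verdict of a `K`-balanced `Φ` being the residue bit `n₋(M, K) = #{t ∈ N_K : 2t < M} ≡ 0` (part 5′
`card_inter_nodd_mod_two_eq`).  The converse («no type of negative norm») is NOT claimed at these levels.

Theorems:
* `exists_type_of_norm_pos_thirtyTwo_sqrt_neg_one`
* `exists_type_of_norm_pos_thirtyTwo_sqrt_neg_two`
* `exists_type_of_norm_pos_forty_sqrt_neg_one`
* `exists_type_of_norm_pos_forty_sqrt_neg_two`
* `exists_type_of_norm_pos_forty_sqrt_neg_five`
* `exists_type_of_norm_pos_forty_sqrt_neg_ten`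

HONEST FRAMING: torus-level statements about Shimura's divisors of type `(K; Φ; 𝔣₀)` [Sh98 §14.3 Prop. 4–5] on
`ℂ^Φ/Φ(ℤ[ζ_M])` and norms of elements of `ℚ(ζ_M)⁺`; nothing here is a statement about Hodge classes, `W_K`, general
members or HC; `HC_CM` is used nowhere.  No `def`, no named fact, no `sorry`.

References: [cite: Shimura1998, §14.3 Prop. 4–5, pp. 103–104]; census b01.36 / b01.41 (seat-derived).
-/

noncomputable section

open Polynomial NumberField Complex Finset
open scoped Real nonZeroDivisors

namespace Summit.HodgeConjecture.Ring2WeilCoverage.TypeNormSignLevelsG8A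

open Literature.AlgebraicGeometry.Motives (CMType)
open Literature.AlgebraicGeometry.HodgeTheory (IsCMTypeSet)
open Literature.AlgebraicGeometry.ComplexMultiplication.CyclotomicCMType (isCMTypeSet_residueFilter)
open Literature.NumberTheory.ComplexMultiplication
open Summit.HodgeConjecture.Ring2WeilCoverage.TypeNormSign
open Summit.HodgeConjecture.Ring2WeilCoverage.CMTypeSetOddPositions (card_inter_nodd_mod_two_eq)
open Summit.HodgeConjecture.Ring2WeilCoverage.CyclotomicSignaturesLevel32 (exists_units_sign_eq_thirtyTwo)
open Summit.HodgeConjecture.Ring2WeilCoverage.CyclotomicSignaturesG8A (exists_units_sign_eq_forty)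

variable {K : Type} [Field K] [NumberField K] {ζ : K}

/-- `𝐞(t) = exp(2πi t/n) ∈ ℂ` (`ZMod.toCircle`). -/
local notation3 (prettyPrint := false) "𝐞 " t:max => ((ZMod.toCircle t : Circle) : ℂ)

/-! ### Level `32` (`g = 16`) -/

section Level32

/-- the residue set `S_Φ` read at level `32`. -/
local notation3 (prettyPrint := false) "SΦ32[" Φ "," z "]" =>
  (Finset.univ.filter fun t : ZMod 32 => ∃ σ ∈ (Φ : CMType K).1, σ (z : K) = 𝐞 t)

open scoped Classical in
/-- **CENSUS ROW `(ℚ(ζ_32), ℚ(i))` (a YES row) — EVERY TYPE OF POSITIVE NORM OCCURS.**  For every CM type `Φ` of `ℚ(ζ_32)`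
balanced for `N_K = [3, 7, 11, 15, 19, 23, 27, 31]` (the Weil signature `(8,8)` on `K = ℚ(i)`) and every real integer `ϖ₀ ∈ 𝓞 K⁺` with
`N_{K⁺/ℚ}(ϖ₀) > 0`: the principal CM torus `ℂ^Φ/Φ(ℤ[ζ_32])` carries a `Φ`-positive divisor of type `(K; Φ; (ϖ₀))` (an
`ι`-compatible polarisation of degree `N_{K⁺/ℚ}(ϖ₀)`).  THEOREM L (ii) at `32` only (part 55b `exists_type_span_of_even_iff`)
+ `|S_Φ ∩ N_odd| ≡ n₋ = 4 ≡ 0` (part 5′); the converse (nothing of negative norm) would need THEOREM L (i) at `32`,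
not in the tree at this level (h = 1).
research route conditional on HC_CM; not a corollary; Q11.4-sentence-2 already refuted in dim ≥ 3. [cite: Shimura1998, §14.3 Prop. 4–5, pp. 103–104] -/
theorem exists_type_of_norm_pos_thirtyTwo_sqrt_neg_one [IsCMField K] [IsCyclotomicExtension {32} ℚ K] (hζ : IsPrimitiveRoot ζ 32)
    (Φ : CMType K) (hbal : 2 * (SΦ32[Φ, ζ] ∩ ({3, 7, 11, 15, 19, 23, 27, 31} : Finset (ZMod 32))).card = (SΦ32[Φ, ζ]).card)
    {ϖ₀ : 𝓞 (maximalRealSubfield K)} (hpos : 0 < Algebra.norm ℚ ((ϖ₀ : maximalRealSubfield K))) :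
    ∃ ζ' : K, IsCMField.complexConj K ζ' = -ζ' ∧ (∀ φ : Φ.1, 0 < (φ.1 ζ').im) ∧
        CMTypeLattice.IsOfType (1 : (FractionalIdeal (𝓞 K)⁰ K)ˣ) ζ' (Ideal.span {ϖ₀}) := by
  have hg : Nat.totient 32 = 2 * (7 + 1) := by decide
  have hϖ0 : ϖ₀ ≠ 0 := by
    rintro rfl
    simp at hpos
  refine exists_type_span_of_even_iff hζ hg Φ hϖ0 (exists_units_sign_eq_thirtyTwo hζ Φ) ?_
  have hS := isCMTypeSet_residueFilter hζ Φ
  have hNK : IsCMTypeSet 32 ({3, 7, 11, 15, 19, 23, 27, 31} : Finset (ZMod 32)) := by decide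
  have h := card_inter_nodd_mod_two_eq (m := 32) (by norm_num) hS hNK hbal
  have hn : ((({3, 7, 11, 15, 19, 23, 27, 31} : Finset (ZMod 32))).filter fun t : ZMod 32 => 2 * t.val < 32).card % 2 = 0 := by
    decide
  rw [hn] at h
  exact ⟨fun _ => hpos, fun _ => Nat.even_iff.mpr h⟩

open scoped Classical in
/-- **CENSUS ROW `(ℚ(ζ_32), ℚ(√−2))` (a YES row) — EVERY TYPE OF POSITIVE NORM OCCURS.**  For every CM type `Φ` of `ℚ(ζ_32)`
balanced for `N_K = [5, 7, 13, 15, 21, 23, 29, 31]` (the Weil signature `(8,8)` on `K = ℚ(√−2)`) and every real integer `ϖ₀ ∈ 𝓞 K⁺` with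
`N_{K⁺/ℚ}(ϖ₀) > 0`: the principal CM torus `ℂ^Φ/Φ(ℤ[ζ_32])` carries a `Φ`-positive divisor of type `(K; Φ; (ϖ₀))` (an
`ι`-compatible polarisation of degree `N_{K⁺/ℚ}(ϖ₀)`).  THEOREM L (ii) at `32` only (part 55b `exists_type_span_of_even_iff`)
+ `|S_Φ ∩ N_odd| ≡ n₋ = 4 ≡ 0` (part 5′); the converse (nothing of negative norm) would need THEOREM L (i) at `32`,
not in the tree at this level (h = 1).
research route conditional on HC_CM; not a corollary; Q11.4-sentence-2 already refuted in dim ≥ 3. [cite: Shimura1998, §14.3 Prop. 4–5, pp. 103–104] -/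
theorem exists_type_of_norm_pos_thirtyTwo_sqrt_neg_two [IsCMField K] [IsCyclotomicExtension {32} ℚ K] (hζ : IsPrimitiveRoot ζ 32)
    (Φ : CMType K) (hbal : 2 * (SΦ32[Φ, ζ] ∩ ({5, 7, 13, 15, 21, 23, 29, 31} : Finset (ZMod 32))).card = (SΦ32[Φ, ζ]).card)
    {ϖ₀ : 𝓞 (maximalRealSubfield K)} (hpos : 0 < Algebra.norm ℚ ((ϖ₀ : maximalRealSubfield K))) :
    ∃ ζ' : K, IsCMField.complexConj K ζ' = -ζ' ∧ (∀ φ : Φ.1, 0 < (φ.1 ζ').im) ∧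
        CMTypeLattice.IsOfType (1 : (FractionalIdeal (𝓞 K)⁰ K)ˣ) ζ' (Ideal.span {ϖ₀}) := by
  have hg : Nat.totient 32 = 2 * (7 + 1) := by decide
  have hϖ0 : ϖ₀ ≠ 0 := by
    rintro rfl
    simp at hpos
  refine exists_type_span_of_even_iff hζ hg Φ hϖ0 (exists_units_sign_eq_thirtyTwo hζ Φ) ?_
  have hS := isCMTypeSet_residueFilter hζ Φ
  have hNK : IsCMTypeSet 32 ({5, 7, 13, 15, 21, 23, 29, 31} : Finset (ZMod 32)) := by decide
  have h := card_inter_nodd_mod_two_eq (m := 32) (by norm_num) hS hNK hbal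
  have hn : ((({5, 7, 13, 15, 21, 23, 29, 31} : Finset (ZMod 32))).filter fun t : ZMod 32 => 2 * t.val < 32).card % 2 = 0 := by
    decide
  rw [hn] at h
  exact ⟨fun _ => hpos, fun _ => Nat.even_iff.mpr h⟩

end Level32

/-! ### Level `40` (`g = 16`) -/

section Level40

/-- the residue set `S_Φ` read at level `40`. -/
local notation3 (prettyPrint := false) "SΦ40[" Φ "," z "]" =>
  (Finset.univ.filter fun t : ZMod 40 => ∃ σ ∈ (Φ : CMType K).1, σ (z : K) = 𝐞 t)

open scoped Classical in
/-- **CENSUS ROW `(ℚ(ζ_40), ℚ(i))` (a YES row) — EVERY TYPE OF POSITIVE NORM OCCURS.**  For every CM type `Φ` of `ℚ(ζ_40)`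
balanced for `N_K = [3, 7, 11, 19, 23, 27, 31, 39]` (the Weil signature `(8,8)` on `K = ℚ(i)`) and every real integer `ϖ₀ ∈ 𝓞 K⁺` with
`N_{K⁺/ℚ}(ϖ₀) > 0`: the principal CM torus `ℂ^Φ/Φ(ℤ[ζ_40])` carries a `Φ`-positive divisor of type `(K; Φ; (ϖ₀))` (an
`ι`-compatible polarisation of degree `N_{K⁺/ℚ}(ϖ₀)`).  THEOREM L (ii) at `40` only (part 55b `exists_type_span_of_even_iff`)
+ `|S_Φ ∩ N_odd| ≡ n₋ = 4 ≡ 0` (part 5′); the converse (nothing of negative norm) would need THEOREM L (i) at `40`,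
not in the tree at this level (h = 1).
research route conditional on HC_CM; not a corollary; Q11.4-sentence-2 already refuted in dim ≥ 3. [cite: Shimura1998, §14.3 Prop. 4–5, pp. 103–104] -/
theorem exists_type_of_norm_pos_forty_sqrt_neg_one [IsCMField K] [IsCyclotomicExtension {40} ℚ K] (hζ : IsPrimitiveRoot ζ 40)
    (Φ : CMType K) (hbal : 2 * (SΦ40[Φ, ζ] ∩ ({3, 7, 11, 19, 23, 27, 31, 39} : Finset (ZMod 40))).card = (SΦ40[Φ, ζ]).card)
    {ϖ₀ : 𝓞 (maximalRealSubfield K)} (hpos : 0 < Algebra.norm ℚ ((ϖ₀ : maximalRealSubfield K))) :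
    ∃ ζ' : K, IsCMField.complexConj K ζ' = -ζ' ∧ (∀ φ : Φ.1, 0 < (φ.1 ζ').im) ∧
        CMTypeLattice.IsOfType (1 : (FractionalIdeal (𝓞 K)⁰ K)ˣ) ζ' (Ideal.span {ϖ₀}) := by
  have hg : Nat.totient 40 = 2 * (7 + 1) := by decide
  have hϖ0 : ϖ₀ ≠ 0 := by
    rintro rfl
    simp at hpos
  refine exists_type_span_of_even_iff hζ hg Φ hϖ0 (exists_units_sign_eq_forty hζ Φ) ?_
  have hS := isCMTypeSet_residueFilter hζ Φ
  have hNK : IsCMTypeSet 40 ({3, 7, 11, 19, 23, 27, 31, 39} : Finset (ZMod 40)) := by decide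
  have h := card_inter_nodd_mod_two_eq (m := 40) (by norm_num) hS hNK hbal
  have hn : ((({3, 7, 11, 19, 23, 27, 31, 39} : Finset (ZMod 40))).filter fun t : ZMod 40 => 2 * t.val < 40).card % 2 = 0 := by
    decide
  rw [hn] at h
  exact ⟨fun _ => hpos, fun _ => Nat.even_iff.mpr h⟩

open scoped Classical in
/-- **CENSUS ROW `(ℚ(ζ_40), ℚ(√−2))` (a YES row) — EVERY TYPE OF POSITIVE NORM OCCURS.**  For every CM type `Φ` of `ℚ(ζ_40)`
balanced for `N_K = [7, 13, 21, 23, 29, 31, 37, 39]` (the Weil signature `(8,8)` on `K = ℚ(√−2)`) and every real integer `ϖ₀ ∈ 𝓞 K⁺` with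
`N_{K⁺/ℚ}(ϖ₀) > 0`: the principal CM torus `ℂ^Φ/Φ(ℤ[ζ_40])` carries a `Φ`-positive divisor of type `(K; Φ; (ϖ₀))` (an
`ι`-compatible polarisation of degree `N_{K⁺/ℚ}(ϖ₀)`).  THEOREM L (ii) at `40` only (part 55b `exists_type_span_of_even_iff`)
+ `|S_Φ ∩ N_odd| ≡ n₋ = 2 ≡ 0` (part 5′); the converse (nothing of negative norm) would need THEOREM L (i) at `40`,
not in the tree at this level (h = 1).
research route conditional on HC_CM; not a corollary; Q11.4-sentence-2 already refuted in dim ≥ 3. [cite: Shimura1998, §14.3 Prop. 4–5, pp. 103–104] -/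
theorem exists_type_of_norm_pos_forty_sqrt_neg_two [IsCMField K] [IsCyclotomicExtension {40} ℚ K] (hζ : IsPrimitiveRoot ζ 40)
    (Φ : CMType K) (hbal : 2 * (SΦ40[Φ, ζ] ∩ ({7, 13, 21, 23, 29, 31, 37, 39} : Finset (ZMod 40))).card = (SΦ40[Φ, ζ]).card)
    {ϖ₀ : 𝓞 (maximalRealSubfield K)} (hpos : 0 < Algebra.norm ℚ ((ϖ₀ : maximalRealSubfield K))) :
    ∃ ζ' : K, IsCMField.complexConj K ζ' = -ζ' ∧ (∀ φ : Φ.1, 0 < (φ.1 ζ').im) ∧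
        CMTypeLattice.IsOfType (1 : (FractionalIdeal (𝓞 K)⁰ K)ˣ) ζ' (Ideal.span {ϖ₀}) := by
  have hg : Nat.totient 40 = 2 * (7 + 1) := by decide
  have hϖ0 : ϖ₀ ≠ 0 := by
    rintro rfl
    simp at hpos
  refine exists_type_span_of_even_iff hζ hg Φ hϖ0 (exists_units_sign_eq_forty hζ Φ) ?_
  have hS := isCMTypeSet_residueFilter hζ Φ
  have hNK : IsCMTypeSet 40 ({7, 13, 21, 23, 29, 31, 37, 39} : Finset (ZMod 40)) := by decide
  have h := card_inter_nodd_mod_two_eq (m := 40) (by norm_num) hS hNK hbal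
  have hn : ((({7, 13, 21, 23, 29, 31, 37, 39} : Finset (ZMod 40))).filter fun t : ZMod 40 => 2 * t.val < 40).card % 2 = 0 := by
    decide
  rw [hn] at h
  exact ⟨fun _ => hpos, fun _ => Nat.even_iff.mpr h⟩

open scoped Classical in
/-- **CENSUS ROW `(ℚ(ζ_40), ℚ(√−5))` (a YES row) — EVERY TYPE OF POSITIVE NORM OCCURS.**  For every CM type `Φ` of `ℚ(ζ_40)`
balanced for `N_K = [11, 13, 17, 19, 31, 33, 37, 39]` (the Weil signature `(8,8)` on `K = ℚ(√−5)`) and every real integer `ϖ₀ ∈ 𝓞 K⁺` with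
`N_{K⁺/ℚ}(ϖ₀) > 0`: the principal CM torus `ℂ^Φ/Φ(ℤ[ζ_40])` carries a `Φ`-positive divisor of type `(K; Φ; (ϖ₀))` (an
`ι`-compatible polarisation of degree `N_{K⁺/ℚ}(ϖ₀)`).  THEOREM L (ii) at `40` only (part 55b `exists_type_span_of_even_iff`)
+ `|S_Φ ∩ N_odd| ≡ n₋ = 4 ≡ 0` (part 5′); the converse (nothing of negative norm) would need THEOREM L (i) at `40`,
not in the tree at this level (h = 1).
research route conditional on HC_CM; not a corollary; Q11.4-sentence-2 already refuted in dim ≥ 3. [cite: Shimura1998, §14.3 Prop. 4–5, pp. 103–104] -/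
theorem exists_type_of_norm_pos_forty_sqrt_neg_five [IsCMField K] [IsCyclotomicExtension {40} ℚ K] (hζ : IsPrimitiveRoot ζ 40)
    (Φ : CMType K) (hbal : 2 * (SΦ40[Φ, ζ] ∩ ({11, 13, 17, 19, 31, 33, 37, 39} : Finset (ZMod 40))).card = (SΦ40[Φ, ζ]).card)
    {ϖ₀ : 𝓞 (maximalRealSubfield K)} (hpos : 0 < Algebra.norm ℚ ((ϖ₀ : maximalRealSubfield K))) :
    ∃ ζ' : K, IsCMField.complexConj K ζ' = -ζ' ∧ (∀ φ : Φ.1, 0 < (φ.1 ζ').im) ∧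
        CMTypeLattice.IsOfType (1 : (FractionalIdeal (𝓞 K)⁰ K)ˣ) ζ' (Ideal.span {ϖ₀}) := by
  have hg : Nat.totient 40 = 2 * (7 + 1) := by decide
  have hϖ0 : ϖ₀ ≠ 0 := by
    rintro rfl
    simp at hpos
  refine exists_type_span_of_even_iff hζ hg Φ hϖ0 (exists_units_sign_eq_forty hζ Φ) ?_
  have hS := isCMTypeSet_residueFilter hζ Φ
  have hNK : IsCMTypeSet 40 ({11, 13, 17, 19, 31, 33, 37, 39} : Finset (ZMod 40)) := by decide
  have h := card_inter_nodd_mod_two_eq (m := 40) (by norm_num) hS hNK hbal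
  have hn : ((({11, 13, 17, 19, 31, 33, 37, 39} : Finset (ZMod 40))).filter fun t : ZMod 40 => 2 * t.val < 40).card % 2 = 0 := by
    decide
  rw [hn] at h
  exact ⟨fun _ => hpos, fun _ => Nat.even_iff.mpr h⟩

open scoped Classical in
/-- **CENSUS ROW `(ℚ(ζ_40), ℚ(√−10))` (a YES row) — EVERY TYPE OF POSITIVE NORM OCCURS.**  For every CM type `Φ` of `ℚ(ζ_40)`
balanced for `N_K = [3, 17, 21, 27, 29, 31, 33, 39]` (the Weil signature `(8,8)` on `K = ℚ(√−10)`) and every real integer `ϖ₀ ∈ 𝓞 K⁺` with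
`N_{K⁺/ℚ}(ϖ₀) > 0`: the principal CM torus `ℂ^Φ/Φ(ℤ[ζ_40])` carries a `Φ`-positive divisor of type `(K; Φ; (ϖ₀))` (an
`ι`-compatible polarisation of degree `N_{K⁺/ℚ}(ϖ₀)`).  THEOREM L (ii) at `40` only (part 55b `exists_type_span_of_even_iff`)
+ `|S_Φ ∩ N_odd| ≡ n₋ = 2 ≡ 0` (part 5′); the converse (nothing of negative norm) would need THEOREM L (i) at `40`,
not in the tree at this level (h = 1).
research route conditional on HC_CM; not a corollary; Q11.4-sentence-2 already refuted in dim ≥ 3. [cite: Shimura1998, §14.3 Prop. 4–5, pp. 103–104] -/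
theorem exists_type_of_norm_pos_forty_sqrt_neg_ten [IsCMField K] [IsCyclotomicExtension {40} ℚ K] (hζ : IsPrimitiveRoot ζ 40)
    (Φ : CMType K) (hbal : 2 * (SΦ40[Φ, ζ] ∩ ({3, 17, 21, 27, 29, 31, 33, 39} : Finset (ZMod 40))).card = (SΦ40[Φ, ζ]).card)
    {ϖ₀ : 𝓞 (maximalRealSubfield K)} (hpos : 0 < Algebra.norm ℚ ((ϖ₀ : maximalRealSubfield K))) :
    ∃ ζ' : K, IsCMField.complexConj K ζ' = -ζ' ∧ (∀ φ : Φ.1, 0 < (φ.1 ζ').im) ∧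
        CMTypeLattice.IsOfType (1 : (FractionalIdeal (𝓞 K)⁰ K)ˣ) ζ' (Ideal.span {ϖ₀}) := by
  have hg : Nat.totient 40 = 2 * (7 + 1) := by decide
  have hϖ0 : ϖ₀ ≠ 0 := by
    rintro rfl
    simp at hpos
  refine exists_type_span_of_even_iff hζ hg Φ hϖ0 (exists_units_sign_eq_forty hζ Φ) ?_
  have hS := isCMTypeSet_residueFilter hζ Φ
  have hNK : IsCMTypeSet 40 ({3, 17, 21, 27, 29, 31, 33, 39} : Finset (ZMod 40)) := by decide
  have h := card_inter_nodd_mod_two_eq (m := 40) (by norm_num) hS hNK hbal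
  have hn : ((({3, 17, 21, 27, 29, 31, 33, 39} : Finset (ZMod 40))).filter fun t : ZMod 40 => 2 * t.val < 40).card % 2 = 0 := by
    decide
  rw [hn] at h
  exact ⟨fun _ => hpos, fun _ => Nat.even_iff.mpr h⟩

end Level40

end Summit.HodgeConjecture.Ring2WeilCoverage.TypeNormSignLevelsG8A

end
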